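import Literature.NumberTheory.EllipticCurves.QuadraticTwistPadicReduction
import Literature.NumberTheory.EllipticCurves.HeegnerHypothesisKroneckerProofs
import Literature.NumberTheory.EllipticCurves.MatsunoTwistedCurvesLocalProofs
import Literature.NumberTheory.EllipticCurves.BSDSelmerSkinnerThmBProofs
import Literature.NumberTheory.EllipticCurves.ModularityVersionApProofs
import Literature.NumberTheory.DiophantineGeometry.LocalReductionProofs
import HarnessLib

/-!
# Class X11b, route p2: transport of multiplicative reduction to the twist by the Heegner field (cell `b2b-bsdres`, sub-cell `multr1-p2`)

HONEST FRAMING (cell `b2b-bsdres`, run/shared/lean/b2b/bsd-rank1-residual/, verbatim in every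
file): the goal of the cell is to DELETE the COMBINATION-SHAPED residual classes of the
Birch–Swinnerton-Dyer formula for ALL analytic-rank `≤ 1` elliptic curves over `ℚ` — "full BSD
formula for every rank `≤ 1` curve in class `C`" assembled STRICTLY from published theorems — so
that the rank-`≤ 1` remainder becomes exactly the CONSTRUCTION-SHAPED classes, which are TYPED
(missing-input `Prop`s), NOT attempted. This is not "finishing BSD". Sub-cell `multr1-p2` is a
RESEARCH ROUTE on class X11b; no claim beyond the stated class and locus.

THEOREMS ONLY (tree plumbing; item (a) of the transport list of
HOME/b2b-bsdres-multr1-p2/REPORT.md §5, discharging one conjunct of the binder `hTw` of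
`X11b/BDPRouteStatement.lean`). For an elliptic curve `E/ℚ` and `d ∈ ℚ^×` a square in `ℚ_q`,
`E^{(d)} ≅ E` over `ℚ_q`, so `E^{(d)}` has multiplicative reduction at `q` iff `E` has
(`hasMultiplicativeReductionAtPrime_quadraticTwist_iff`; the tree had the split-multiplicative case,
`hasSplitMultiplicativeReductionAtPrime_quadraticTwist_iff`, Matsuno 2009 proof of Cor. 6.2). For an
imaginary quadratic `K` in which every prime of the conductor splits (the Heegner hypothesis) and an
odd prime `p` of multiplicative reduction, `p ∣ N` splits in `K`, so `(d_K/p) = 1` and `d_K` is a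
square in `ℚ_p` (Hensel; tree `padic_isSquare_of_jacobiSym_eq_one`); hence EVERY `ℚ`-model `Wd` of
the twist `E^{(d_K)}` has multiplicative reduction at `p`
(`hasMultiplicativeReductionAtPrime_twist_of_heegner`). Silverman, *AEC* VII.5 Prop. 5.1(b),
VII.1 Prop. 1.3(b), X.5 Cor. 5.4; Serre, *Cours d'arithmétique* II.3.3.

References: [SilvermanAEC2009] VII.5 Prop. 5.1, X.5 Cor. 5.4; [Matsuno2009] proof of Cor. 6.2;
[Serre1973] II §3.3 Thm. 3.
-/

noncomputable section

open scoped Classical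

open WeierstrassCurve NumberField Literature.NumberTheory.EllipticCurves

namespace Summit.BirchSwinnertonDyer.Rank1Residual.X11b

/-- **Twisting by a `q`-adic square does not change multiplicative reduction at `q`.** For an
elliptic curve `E/ℚ` and `d ∈ ℚ^×` with `d` a square in `ℚ_q`: `E^{(d)}` has multiplicative reduction
at `q` iff `E` has — over `ℚ_q`, `E^{(d)} = E^{(θ²)} ≅ E` (`map_quadraticTwist`,
`exists_variableChange_smul_eq_quadraticTwist_sq`), and multiplicative reduction is read off any two
`ℚ_q`-isomorphic minimal equations (`hasMultiplicativeReduction_iff_of_isMinimal_of_eq_smul`,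
Silverman, *AEC* VII.5 Prop. 5.1(b) with VII.1 Prop. 1.3(b)). The split-multiplicative analogue is the
tree's `hasSplitMultiplicativeReductionAtPrime_quadraticTwist_iff` (Matsuno 2009, proof of Cor. 6.2).
[cite: SilvermanAEC2009, VII.5 Prop. 5.1(b), VII.1 Prop. 1.3(b) and X.5 Cor. 5.4] -/
theorem hasMultiplicativeReductionAtPrime_quadraticTwist_iff (E : WeierstrassCurve ℚ) [E.IsElliptic]
    {q : ℕ} [Fact q.Prime] {d : ℚ} (hd : d ≠ 0) (hsq : IsSquare (algebraMap ℚ ℚ_[q] d)) :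
    (E.quadraticTwist d).HasMultiplicativeReductionAtPrime q ↔
      E.HasMultiplicativeReductionAtPrime q := by
  obtain ⟨θ, hθ⟩ := hsq
  have hθ0 : θ ≠ 0 := by
    rintro rfl
    exact (map_ne_zero (algebraMap ℚ ℚ_[q])).mpr hd (hθ.trans (mul_zero 0))
  haveI : (E.baseChange ℚ_[q]).IsElliptic :=
    inferInstanceAs (E.map (algebraMap ℚ ℚ_[q])).IsElliptic
  haveI hEt : (E.quadraticTwist d).IsElliptic := E.isElliptic_quadraticTwist hd
  haveI : ((E.quadraticTwist d).baseChange ℚ_[q]).IsElliptic :=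
    inferInstanceAs ((E.quadraticTwist d).map (algebraMap ℚ ℚ_[q])).IsElliptic
  obtain ⟨C, hC⟩ := (E.baseChange ℚ_[q]).exists_variableChange_smul_eq_quadraticTwist_sq hθ0
  -- `E^{(d)} ⊗ ℚ_q = C • (E ⊗ ℚ_q)`
  have h1 : (E.quadraticTwist d).baseChange ℚ_[q] = C • E.baseChange ℚ_[q] := by
    rw [hC, baseChange, baseChange, map_quadraticTwist, hθ, sq]
  unfold HasMultiplicativeReductionAtPrime
  set X : WeierstrassCurve ℚ_[q] := E.baseChange ℚ_[q] with hX
  set Y : WeierstrassCurve ℚ_[q] := (E.quadraticTwist d).baseChange ℚ_[q] with hY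
  set D₁ : VariableChange ℚ_[q] := (X.exists_isMinimal ℤ_[q]).choose with hD₁
  set D₂ : VariableChange ℚ_[q] := (Y.exists_isMinimal ℤ_[q]).choose with hD₂
  have hm₁ : X.minimal ℤ_[q] = D₁ • X := rfl
  have hm₂ : Y.minimal ℤ_[q] = D₂ • Y := rfl
  have h : Y.minimal ℤ_[q] = (D₂ * C * D₁⁻¹) • X.minimal ℤ_[q] := by
    rw [hm₂, h1, hm₁, mul_smul, mul_smul, inv_smul_smul]
  have hΔ : (X.minimal ℤ_[q]).Δ ≠ 0 := by
    rw [hm₁, variableChange_Δ]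
    exact mul_ne_zero (by simp) X.isUnit_Δ.ne_zero
  exact hasMultiplicativeReduction_iff_of_isMinimal_of_eq_smul ℤ_[q] h hΔ

/-- **Under the Heegner hypothesis, every model of the twist `E^{(d_K)}` is again multiplicative at an
odd multiplicative prime `p`.** Let `E/ℚ` (model `W`) have multiplicative reduction at the odd prime
`p`, and let `K` be an imaginary quadratic field satisfying the Heegner hypothesis for the conductor
`N` of `E` (every prime of `N` splits in `K`). Then `p ∣ N`
(`dvd_conductorNorm_iff_not_hasGoodReductionAtPrime`), so `p` splits in `K`, `(d_K/p) = 1`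
(`SatisfiesHeegnerHypothesis.jacobiSym_discr_eq_one`), `d_K` is a square in `ℚ_p` (Hensel,
`padic_isSquare_of_jacobiSym_eq_one`), and for every change of variables `Cd` over `ℚ` the model
`Wd = Cd • W^{(d_K)}` has multiplicative reduction at `p`
(`hasMultiplicativeReductionAtPrime_quadraticTwist_iff`, `hasMultiplicativeReductionAtPrime_smul_iff`).
This discharges the conjunct "`Wd` multiplicative at `p`" of the twist-transport binder of
`X11b/BDPRouteStatement.lean`. [cite: SilvermanAEC2009, VII.5 Prop. 5.1(b) and X.5 Cor. 5.4]
[cite: Serre1973, Ch. II §3.3 Thm 3] -/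
theorem hasMultiplicativeReductionAtPrime_twist_of_heegner (W : WeierstrassCurve ℚ) [W.IsElliptic]
    (p : ℕ) [Fact p.Prime] (K : Type) [Field K] [NumberField K] (hK : IsImaginaryQuadratic K)
    (hH : SatisfiesHeegnerHypothesis (W.conductorNorm ℤ) K) (hp2 : p ≠ 2)
    (hmult : W.HasMultiplicativeReductionAtPrime p) {Wd : WeierstrassCurve ℚ} (Cd : VariableChange ℚ)
    (hWd : Cd • W.quadraticTwist (NumberField.discr K : ℚ) = Wd) :
    Wd.HasMultiplicativeReductionAtPrime p := by
  have hp : p.Prime := Fact.out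
  have hD0 : (NumberField.discr K : ℚ) ≠ 0 := by exact_mod_cast NumberField.discr_ne_zero K
  haveI : (W.quadraticTwist (NumberField.discr K : ℚ)).IsElliptic := W.isElliptic_quadraticTwist hD0
  -- `p ∣ N`
  have hpN : p ∣ W.conductorNorm ℤ :=
    (W.dvd_conductorNorm_iff_not_hasGoodReductionAtPrime p).mpr
      (WeierstrassCurve.HasMultiplicativeReduction.not_hasGoodReduction (R := ℤ_[p]) hmult)
  -- `(d_K / p) = 1`, hence `d_K` is a square in `ℚ_p`
  have hj : jacobiSym (NumberField.discr K) p = 1 :=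
    Literature.SatisfiesHeegnerHypothesis.jacobiSym_discr_eq_one hK.1 hH hp hpN hp2
  have hsq : IsSquare (algebraMap ℚ ℚ_[p] (NumberField.discr K : ℚ)) := by
    have := padic_isSquare_of_jacobiSym_eq_one (q := p) hp2 hj
    simpa using this
  rw [← hWd, hasMultiplicativeReductionAtPrime_smul_iff]
  exact (hasMultiplicativeReductionAtPrime_quadraticTwist_iff W hD0 hsq).mpr hmult

end Summit.BirchSwinnertonDyer.Rank1Residual.X11b

end
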